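import Summits.Parity.GeneralizedHardyLittlewood.Theorems.BeyondDiagonalBeatsQuarter.OffDiagCoreRangeThreshold
import HarnessLib

/-!
# Route `PrimeLevelFamEdge`, crux K_B (stmt-Parity-20343), line `diagonal_kernel_split` rev 4, plan Ω,
# node **L7d part 2, leaf C — completion of a CONVEX level cut (range ∧ window ∧ block) at cost `2(2 + log P)`**
# (L7D-PLAN rev 5 §5 (3); companion of `OffDiagCoreRangeThreshold` (D3′) and `OffDiagCoreLevelsWindow` (W))

In the windowed family `coreWin` a member `x = (cell, h₁, s)` sees the level `q` through three cuts, all INTERVALS in `q`: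
the range cut `coreRange … q = [y_x ≤ q]` (D3′, an up-set), the window `|s + ab/(q(r+1))| ≤ T` (`ab/(q(r+1))` is antitone
in `q`), and the large-sieve block `β₁ ≤ q ≤ β₂`. Their conjunction is a CONVEX cut `p` on `[1, P−1]`, i.e. `[Y₁ ≤ q ≤ Y₂]`,
and the tree's Vaughan-Lemma-2 device (`LargeSieve.ite_le_eq_sum_e_mul_sepCoeff`) expands it EXACTLY:
`𝟙[p q] = Σ_{k<P} e(kq/P)·convexCoeff p P k`, `convexCoeff = sepCoeff P Y₂ k − sepCoeff P (Y₁−1) k`, with the `p`-FREE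
majorant `2·sepWeight P k`, `Σ_k ≤ 2(2 + log P)`. The twist `e(kq/P)` joins the universal level weight, the coefficient the
family weight — so ONE large-sieve application per `k` serves every member whatever its window.

* convexity (spelled-out hypothesis): `levelConvex_of_mono`, `levelConvex_and`, `levelConvex_Icc`, `levelConvex_window`,
  `levelConvex_coreRange`;
* `convexCoeff`, `norm_convexCoeff_le`, `sum_norm_convexCoeff_le`;
* `ite_Icc_eq_sum_e_mul`, **`ite_convex_eq_sum_e_mul`**, **`sum_ite_convex_eq_completed`**.

Finite sums only; standard axioms. Helper toward `stub_offDiagBelowSlack_io`; closes nothing.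
«The programme SEARCHES and TYPES; no claim about Landau–Siegel zeros, Theorems 1–2 of arXiv:2211.02515 or
a repaired Margin232 until a kernel theorem says so.»
-/

noncomputable section

open Finset
open scoped Real

namespace Summit.Parity.GeneralizedHardyLittlewood.Theorems.BeyondDiagonalBeatsQuarter.OffDiag

open Literature.NumberTheory.Sieve.LargeSieve (e sepCoeff sepWeight norm_sepCoeff_le sum_sepWeight_le sepWeight_nonneg
  ite_le_eq_sum_e_mul_sepCoeff)

variable {P : ℕ}

/-! ### §1. Convex level cuts -/

/-! A level cut `p` is CONVEX on `[1, P−1]` when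
`∀ q₁ q₂ q₃ ∈ [1,P−1]-ends, q₁ ≤ q₂ ≤ q₃ → p q₁ → p q₃ → p q₂`; this hypothesis is spelled out in each statement. -/

/-- An up-set (monotone cut) on `q ≥ 1` is convex. [folklore] -/
theorem levelConvex_of_mono {p : ℕ → Prop} (hmono : ∀ q q' : ℕ, 1 ≤ q → q ≤ q' → p q → p q') :
    (∀ q₁ q₂ q₃ : ℕ, q₁ ∈ Finset.Icc 1 (P - 1) → q₃ ∈ Finset.Icc 1 (P - 1) → q₁ ≤ q₂ → q₂ ≤ q₃ → p q₁ → p q₃ → p q₂) :=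
  fun q₁ q₂ _ hq₁ _ h12 _ hp₁ _ ↦ hmono q₁ q₂ (Finset.mem_Icc.mp hq₁).1 h12 hp₁

/-- The conjunction of two convex cuts is convex. [folklore] -/
theorem levelConvex_and {p₁ p₂ : ℕ → Prop}
    (h₁ : (∀ q₁ q₂ q₃ : ℕ, q₁ ∈ Finset.Icc 1 (P - 1) → q₃ ∈ Finset.Icc 1 (P - 1) → q₁ ≤ q₂ → q₂ ≤ q₃ → p₁ q₁ → p₁ q₃ → p₁ q₂))
    (h₂ : (∀ q₁ q₂ q₃ : ℕ, q₁ ∈ Finset.Icc 1 (P - 1) → q₃ ∈ Finset.Icc 1 (P - 1) → q₁ ≤ q₂ → q₂ ≤ q₃ → p₂ q₁ → p₂ q₃ → p₂ q₂)) :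
    (∀ q₁ q₂ q₃ : ℕ, q₁ ∈ Finset.Icc 1 (P - 1) → q₃ ∈ Finset.Icc 1 (P - 1) → q₁ ≤ q₂ → q₂ ≤ q₃ → (fun q ↦ p₁ q ∧ p₂ q) q₁ → (fun q ↦ p₁ q ∧ p₂ q) q₃ → (fun q ↦ p₁ q ∧ p₂ q) q₂) :=
  fun q₁ q₂ q₃ hq₁ hq₃ h12 h23 hp₁ hp₃ ↦
    ⟨h₁ q₁ q₂ q₃ hq₁ hq₃ h12 h23 hp₁.1 hp₃.1, h₂ q₁ q₂ q₃ hq₁ hq₃ h12 h23 hp₁.2 hp₃.2⟩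

/-- A block `[β₁, β₂]` is a convex cut. [folklore] -/
theorem levelConvex_Icc (β₁ β₂ : ℕ) :
    (∀ q₁ q₂ q₃ : ℕ, q₁ ∈ Finset.Icc 1 (P - 1) → q₃ ∈ Finset.Icc 1 (P - 1) → q₁ ≤ q₂ → q₂ ≤ q₃ → (fun q ↦ β₁ ≤ q ∧ q ≤ β₂) q₁ → (fun q ↦ β₁ ≤ q ∧ q ≤ β₂) q₃ → (fun q ↦ β₁ ≤ q ∧ q ≤ β₂) q₂) :=
  fun _ _ _ _ _ h12 h23 hp₁ hp₃ ↦ ⟨le_trans hp₁.1 h12, le_trans h23 hp₃.2⟩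

/-- **The `s`-window is a convex cut**: for `u ≥ 0`, `c ≥ 1`, `q ↦ u/(qc)` is antitone on `q ≥ 1`, so
`{q : ¬ (T < |s + u/(qc)|)}` is an interval. [folklore] -/
theorem levelConvex_window {u : ℝ} (hu : 0 ≤ u) {c : ℕ} (hc : 1 ≤ c) (s : ℝ) (T : ℝ) :
    (∀ q₁ q₂ q₃ : ℕ, q₁ ∈ Finset.Icc 1 (P - 1) → q₃ ∈ Finset.Icc 1 (P - 1) → q₁ ≤ q₂ → q₂ ≤ q₃ → (fun q ↦ ¬ (T < |s + u / ((q * c : ℕ) : ℝ)|)) q₁ → (fun q ↦ ¬ (T < |s + u / ((q * c : ℕ) : ℝ)|)) q₃ → (fun q ↦ ¬ (T < |s + u / ((q * c : ℕ) : ℝ)|)) q₂) := by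
  intro q₁ q₂ q₃ hq₁ _ h12 h23 hp₁ hp₃
  simp only [not_lt] at hp₁ hp₃ ⊢
  have hq₁1 : 1 ≤ q₁ := (Finset.mem_Icc.mp hq₁).1
  have hpos : ∀ q : ℕ, 1 ≤ q → (0 : ℝ) < ((q * c : ℕ) : ℝ) := fun q hq ↦ by
    have : 0 < q * c := Nat.mul_pos (by omega) (by omega)
    exact_mod_cast this
  have hanti : ∀ q q' : ℕ, 1 ≤ q → q ≤ q' → u / ((q' * c : ℕ) : ℝ) ≤ u / ((q * c : ℕ) : ℝ) := fun q q' hq hqq' ↦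
    div_le_div_of_nonneg_left hu (hpos q hq) (by exact_mod_cast Nat.mul_le_mul_right c hqq')
  have h1 := hanti q₁ q₂ hq₁1 h12
  have h2 := hanti q₂ q₃ (le_trans hq₁1 h12) h23
  rw [abs_le] at hp₁ hp₃ ⊢
  constructor <;> linarith [hp₁.1, hp₁.2, hp₃.1, hp₃.2]

/-- **The range cut `coreRange` is a convex cut** (`Δ′, ε₀ ≥ 0`): it is an up-set in `q` (`coreRange_mono`).
[folklore] -/
theorem levelConvex_coreRange {Δ' ε₀ : ℝ} (hΔ : 0 ≤ Δ') (hε₀ : 0 ≤ ε₀) (r l m d₁ d₂ : ℕ) (i : ℕ × ℕ) (h₁ : ℤ) :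
    (∀ q₁ q₂ q₃ : ℕ, q₁ ∈ Finset.Icc 1 (P - 1) → q₃ ∈ Finset.Icc 1 (P - 1) → q₁ ≤ q₂ → q₂ ≤ q₃ → (fun q ↦ coreRange Δ' ε₀ r l m d₁ d₂ i h₁ q) q₁ → (fun q ↦ coreRange Δ' ε₀ r l m d₁ d₂ i h₁ q) q₃ → (fun q ↦ coreRange Δ' ε₀ r l m d₁ d₂ i h₁ q) q₂) :=
  levelConvex_of_mono (p := fun q ↦ coreRange Δ' ε₀ r l m d₁ d₂ i h₁ q)
    fun _ _ hq hqq' hp ↦ coreRange_mono hΔ hε₀ hq hqq' hp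

/-! ### §2. The completion coefficients of a convex cut -/

open Classical in
/-- **Completion coefficients of a convex cut** `p` on `[1, P−1]`: with `S = {q ∈ [1,P−1] : p q} = [Y₁, Y₂]`,
`convexCoeff p P k = sepCoeff P Y₂ k − sepCoeff P (Y₁−1) k` (and `0` if `S = ∅`). [cite: Vaughan1980, Lemma 2 — derivation] -/
def convexCoeff (p : ℕ → Prop) (P k : ℕ) : ℂ :=
  if h : ((Finset.Icc 1 (P - 1)).filter (fun q ↦ p q)).Nonempty then
    sepCoeff P (((Finset.Icc 1 (P - 1)).filter (fun q ↦ p q)).max' h) k -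
      sepCoeff P (((Finset.Icc 1 (P - 1)).filter (fun q ↦ p q)).min' h - 1) k
  else 0

/-- The `p`-free majorant: `‖convexCoeff p P k‖ ≤ 2·sepWeight P k` for `k < P`. [cite: Vaughan1980, Lemma 2 — derivation] -/
theorem norm_convexCoeff_le (p : ℕ → Prop) {k : ℕ} (hk : k < P) : ‖convexCoeff p P k‖ ≤ 2 * sepWeight P k := by
  classical
  unfold convexCoeff
  split_ifs with h
  · set S := (Finset.Icc 1 (P - 1)).filter (fun q ↦ p q) with hS
    have hmax : S.max' h ∈ Finset.Icc 1 (P - 1) := (Finset.mem_filter.mp (S.max'_mem h)).1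
    have hmin : S.min' h ∈ Finset.Icc 1 (P - 1) := (Finset.mem_filter.mp (S.min'_mem h)).1
    have h2 : S.max' h < P := by have := (Finset.mem_Icc.mp hmax).2; omega
    have h1 : S.min' h - 1 < P := by have := (Finset.mem_Icc.mp hmin).2; omega
    calc _ ≤ ‖sepCoeff P (S.max' h) k‖ + ‖sepCoeff P (S.min' h - 1) k‖ := norm_sub_le _ _
      _ ≤ sepWeight P k + sepWeight P k := add_le_add (norm_sepCoeff_le hk h2) (norm_sepCoeff_le hk h1)
      _ = 2 * sepWeight P k := by ring
  · rw [norm_zero]; exact mul_nonneg zero_le_two (sepWeight_nonneg P k)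

/-- `Σ_{k<P} ‖convexCoeff p P k‖ ≤ 2(2 + log P)` (`P ≥ 1`). [cite: Vaughan1980, Lemma 2 — derivation] -/
theorem sum_norm_convexCoeff_le (p : ℕ → Prop) (hP : 1 ≤ P) :
    ∑ k ∈ Finset.range P, ‖convexCoeff p P k‖ ≤ 2 * (2 + Real.log P) := by
  calc _ ≤ ∑ k ∈ Finset.range P, 2 * sepWeight P k :=
        Finset.sum_le_sum fun k hk ↦ norm_convexCoeff_le p (Finset.mem_range.mp hk)
    _ = 2 * ∑ k ∈ Finset.range P, sepWeight P k := by rw [Finset.mul_sum]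
    _ ≤ 2 * (2 + Real.log P) := mul_le_mul_of_nonneg_left (sum_sepWeight_le (by omega)) zero_le_two

/-! ### §3. The exact expansion -/

/-- **Two-sided cut**: for `q < P`, `1 ≤ Y₁ ≤ Y₂ < P`:
`𝟙[Y₁ ≤ q ≤ Y₂] = Σ_{k<P} e(kq/P)·(sepCoeff P Y₂ k − sepCoeff P (Y₁−1) k)`. [cite: Vaughan1980, Lemma 2 — derivation] -/
theorem ite_Icc_eq_sum_e_mul {q Y₁ Y₂ : ℕ} (hq : q < P) (hY₁ : 1 ≤ Y₁) (hY : Y₁ ≤ Y₂) (hY₂ : Y₂ < P)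
    [Decidable (Y₁ ≤ q ∧ q ≤ Y₂)] :
    (if Y₁ ≤ q ∧ q ≤ Y₂ then (1 : ℂ) else 0) =
      ∑ k ∈ Finset.range P, e ((k : ℝ) * q / P) * (sepCoeff P Y₂ k - sepCoeff P (Y₁ - 1) k) := by
  have hsplit : (if Y₁ ≤ q ∧ q ≤ Y₂ then (1 : ℂ) else 0) =
      (if q ≤ Y₂ then (1 : ℂ) else 0) - (if q ≤ Y₁ - 1 then (1 : ℂ) else 0) := by
    by_cases ha : Y₁ ≤ q <;> by_cases hb : q ≤ Y₂
    · rw [if_pos ⟨ha, hb⟩, if_pos hb, if_neg (by omega)]; ring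
    · rw [if_neg (fun h ↦ hb h.2), if_neg hb, if_neg (by omega)]; ring
    · rw [if_neg (fun h ↦ ha h.1), if_pos hb, if_pos (by omega)]; ring
    · rw [if_neg (fun h ↦ ha h.1), if_neg hb]
      exfalso; omega
  rw [hsplit, ite_le_eq_sum_e_mul_sepCoeff hq hY₂, ite_le_eq_sum_e_mul_sepCoeff hq (by omega),
    ← Finset.sum_sub_distrib]
  exact Finset.sum_congr rfl fun k _ ↦ by ring

open Classical in
/-- **Exact expansion of a convex cut**: for `p` convex on `[1, P−1]` and `q ∈ [1, P−1]`,
`𝟙[p q] = Σ_{k<P} e(kq/P)·convexCoeff p P k`. [cite: Vaughan1980, Lemma 2 — derivation] -/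
theorem ite_convex_eq_sum_e_mul {p : ℕ → Prop}
    (hp : (∀ q₁ q₂ q₃ : ℕ, q₁ ∈ Finset.Icc 1 (P - 1) → q₃ ∈ Finset.Icc 1 (P - 1) → q₁ ≤ q₂ → q₂ ≤ q₃ → p q₁ → p q₃ → p q₂))
    {q : ℕ} (hq : q ∈ Finset.Icc 1 (P - 1)) :
    (if p q then (1 : ℂ) else 0) = ∑ k ∈ Finset.range P, e ((k : ℝ) * q / P) * convexCoeff p P k := by
  have hqP : q < P := by have := (Finset.mem_Icc.mp hq).2; have := (Finset.mem_Icc.mp hq).1; omega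
  set S := (Finset.Icc 1 (P - 1)).filter (fun q ↦ p q) with hS
  by_cases hne : S.Nonempty
  · have hmaxS := S.max'_mem hne
    have hminS := S.min'_mem hne
    have hmax : S.max' hne ∈ Finset.Icc 1 (P - 1) := (Finset.mem_filter.mp hmaxS).1
    have hmin : S.min' hne ∈ Finset.Icc 1 (P - 1) := (Finset.mem_filter.mp hminS).1
    have hiff : p q ↔ S.min' hne ≤ q ∧ q ≤ S.max' hne := by
      constructor
      · intro hpq
        have hqS : q ∈ S := Finset.mem_filter.mpr ⟨hq, hpq⟩
        exact ⟨S.min'_le q hqS, S.le_max' q hqS⟩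
      · rintro ⟨h1, h2⟩
        exact hp _ _ _ hmin hmax h1 h2 (Finset.mem_filter.mp hminS).2 (Finset.mem_filter.mp hmaxS).2
    have hY₁ : 1 ≤ S.min' hne := (Finset.mem_Icc.mp hmin).1
    have hY : S.min' hne ≤ S.max' hne := S.min'_le _ hmaxS
    have hY₂ : S.max' hne < P := by have := (Finset.mem_Icc.mp hmax).2; omega
    have hcoef : ∀ k : ℕ, convexCoeff p P k = sepCoeff P (S.max' hne) k - sepCoeff P (S.min' hne - 1) k := by
      intro k; unfold convexCoeff; rw [dif_pos hne]
    simp only [hcoef]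
    rw [← ite_Icc_eq_sum_e_mul hqP hY₁ hY hY₂]
    by_cases hpq : p q
    · rw [if_pos hpq, if_pos (hiff.mp hpq)]
    · rw [if_neg hpq, if_neg (fun h ↦ hpq (hiff.mpr h))]
  · have hpq : ¬ p q := fun h ↦ hne ⟨q, Finset.mem_filter.mpr ⟨hq, h⟩⟩
    have hcoef : ∀ k : ℕ, convexCoeff p P k = 0 := by
      intro k; unfold convexCoeff; rw [dif_neg hne]
    simp only [hcoef, mul_zero, Finset.sum_const_zero, if_neg hpq]

open Classical in
/-- **Completion of a convex cut across a level set.** For `p` convex on `[1, P−1]`, `G ⊆ [1, P−1]` and any `F`: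
`Σ_{q∈G} 𝟙[p q]·F q = Σ_{k<P} convexCoeff p P k · Σ_{q∈G} e(kq/P)·F q` — the coefficients have the `p`-free
majorant `2·sepWeight P k` (`norm_convexCoeff_le`, total `≤ 2(2 + log P)`). [cite: Vaughan1980, Lemma 2 — derivation] -/
theorem sum_ite_convex_eq_completed {p : ℕ → Prop}
    (hp : (∀ q₁ q₂ q₃ : ℕ, q₁ ∈ Finset.Icc 1 (P - 1) → q₃ ∈ Finset.Icc 1 (P - 1) → q₁ ≤ q₂ → q₂ ≤ q₃ → p q₁ → p q₃ → p q₂)) (G : Finset ℕ)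
    (hG : G ⊆ Finset.Icc 1 (P - 1)) (F : ℕ → ℂ) :
    ∑ q ∈ G, (if p q then F q else 0) =
      ∑ k ∈ Finset.range P, convexCoeff p P k * ∑ q ∈ G, e ((k : ℝ) * q / P) * F q := by
  have hpt : ∀ q ∈ G, (if p q then F q else 0) =
      ∑ k ∈ Finset.range P, convexCoeff p P k * (e ((k : ℝ) * q / P) * F q) := by
    intro q hq
    have h1 : (if p q then F q else 0) = (if p q then (1 : ℂ) else 0) * F q := by
      split_ifs <;> simp
    rw [h1, ite_convex_eq_sum_e_mul hp (hG hq), Finset.sum_mul]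
    exact Finset.sum_congr rfl fun k _ ↦ by ring
  rw [Finset.sum_congr rfl hpt, Finset.sum_comm]
  exact Finset.sum_congr rfl fun k _ ↦ by rw [Finset.mul_sum]

/-- **The norm form consumed by the large sieve**: if every twisted level functional is bounded, `‖V k‖ ≤ B`, then
`‖Σ_{k<P} convexCoeff p P k · V k‖ ≤ 2(2 + log P)·B`. [cite: Vaughan1980, Lemma 2 — derivation] -/
theorem norm_sum_convexCoeff_mul_le (p : ℕ → Prop) (hP : 1 ≤ P) (V : ℕ → ℂ) {B : ℝ}
    (hV : ∀ k ∈ Finset.range P, ‖V k‖ ≤ B) :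
    ‖∑ k ∈ Finset.range P, convexCoeff p P k * V k‖ ≤ 2 * (2 + Real.log P) * B := by
  have hB0 : 0 ≤ B := (norm_nonneg _).trans (hV 0 (Finset.mem_range.mpr (by omega)))
  calc _ ≤ ∑ k ∈ Finset.range P, ‖convexCoeff p P k‖ * B := by
        refine (norm_sum_le _ _).trans (Finset.sum_le_sum fun k hk ↦ ?_)
        rw [norm_mul]
        exact mul_le_mul_of_nonneg_left (hV k hk) (norm_nonneg _)
    _ = (∑ k ∈ Finset.range P, ‖convexCoeff p P k‖) * B := by rw [Finset.sum_mul]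
    _ ≤ 2 * (2 + Real.log P) * B := mul_le_mul_of_nonneg_right (sum_norm_convexCoeff_le p hP) hB0

end Summit.Parity.GeneralizedHardyLittlewood.Theorems.BeyondDiagonalBeatsQuarter.OffDiag
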